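import Summits.CriticalPhenomena.Ising3DConformalLimit.Theorems.ReflectionTwinExistsContinuousLimitCubeChain
import Literature.Probability.LatticeModels.GKSInequalities
import Literature.Probability.LatticeModels.SharpnessProofs
import HarnessLib

/-!
# The cube deficit dominates the axis-box deficit (GKS volume monotonicity)

Crux `ExistsContinuousLimit` (item stmt-CriticalPhenomena-4582), line `free-box-deficit` (lead c7). Book-keeping for the reshape
`{stub_axisBoxDeficit, stub_diagBoxDeficit} ↦ {stub_cubeDeficit}`: the axis box `A_n = (−h,n+h)×(−h,h)²` sits inside the cube
`C_n = (−h,n+h)×(−n,n)²`, so by Griffiths' volume monotonicity of free correlations `freeA(n) ≤ freeC(n)`, and the single new stub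
(`freeC ≤ (1−c) g`) implies c5's registered `stub_axisBoxDeficit` (`freeA ≤ (1−c) g`) with the same constant. (The diagonal deficit is
not needed by the cube chain at all.)
-/

noncomputable section

namespace Summit.CriticalPhenomena.Ising3DConformalLimit.ReflectionTwinExistsContinuousLimit.FreeBox

open Finset
open scoped BigOperators
open Literature.Probability.LatticeModels
open Classical

/-- **`freeA(n) ≤ freeC(n)`**: the free two-point function of the axis box is at most that of the cube containing it
(GKS II volume monotonicity). [cite: FriedliVelenik2017, Exercise 3.12, p. 112] -/
theorem freeA_le_freeC (n : ℕ) (hn : 1 ≤ n) :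
    isingTwoPoint (zdGraph 3)
        (Fintype.piFinset fun i : Fin 3 => Finset.Icc ((fun _ : Fin 3 => 1 - (((n + 1) / 2 : ℕ) : ℤ)) i)
          ((fun i : Fin 3 => if i = 0 then (n : ℤ) + (((n + 1) / 2 : ℕ) : ℤ) - 1 else (((n + 1) / 2 : ℕ) : ℤ) - 1) i))
        (criticalBeta 3) 0 .free 0 (Pi.single 0 (n : ℤ)) ≤
      isingTwoPoint (zdGraph 3)
        (Fintype.piFinset fun i : Fin 3 => Finset.Icc ((fun i : Fin 3 => if i = 0 then 1 - (((n + 1) / 2 : ℕ) : ℤ) else 1 - (n : ℤ)) i)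
          ((fun i : Fin 3 => if i = 0 then (n : ℤ) + (((n + 1) / 2 : ℕ) : ℤ) - 1 else (n : ℤ) - 1) i))
        (criticalBeta 3) 0 .free 0 (Pi.single 0 (n : ℤ)) := by
  have hne : (0 : Site 3) ≠ Pi.single 0 (n : ℤ) := by
    intro h; have := congrFun h 0; simp at this; omega
  rw [isingTwoPoint_eq_isingCorr (zdGraph 3) _ _ _ _ hne, isingTwoPoint_eq_isingCorr (zdGraph 3) _ _ _ _ hne]
  refine isingCorr_free_le_of_subset (zdGraph 3) (criticalBeta_nonneg 3) le_rfl ?_ ?_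
  · -- `{0, ne₀} ⊆ A_n`
    intro w hw
    rw [Fintype.mem_piFinset]
    rcases Finset.mem_insert.1 hw with rfl | hw
    · intro i; fin_cases i <;> simp <;> omega
    · rw [Finset.mem_singleton.1 hw]; intro i; fin_cases i <;> simp <;> omega
  · -- `A_n ⊆ C_n`
    intro w hw
    rw [Fintype.mem_piFinset] at hw ⊢
    intro i
    have h := hw i
    rw [Finset.mem_Icc] at h ⊢
    fin_cases i
    · simpa using h
    · simp at h ⊢; omega
    · simp at h ⊢; omega

/-- **Registered sub-goal `axisBoxDeficit_of_cubeDeficit`** (verbatim signature): the cube deficit (the line's single open stub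
`stub_cubeDeficit`) implies c5's registered `stub_axisBoxDeficit`, with the same constant. [folklore] -/
theorem axisBoxDeficit_of_cubeDeficit : (∃ c : ℝ, 0 < c ∧ ∀ n : ℕ, 1 ≤ n → Literature.Probability.LatticeModels.isingTwoPoint (Literature.Probability.LatticeModels.zdGraph 3) (Fintype.piFinset fun i : Fin 3 => Finset.Icc ((fun i : Fin 3 => if i = 0 then 1 - (((n + 1) / 2 : ℕ) : ℤ) else 1 - (n : ℤ)) i) ((fun i : Fin 3 => if i = 0 then (n : ℤ) + (((n + 1) / 2 : ℕ) : ℤ) - 1 else (n : ℤ) - 1) i)) (Literature.Probability.LatticeModels.criticalBeta 3) 0 .free 0 (Pi.single 0 (n : ℤ)) ≤ (1 - c) * Literature.Probability.LatticeModels.criticalTwoPoint 3 (Pi.single 0 (n : ℤ))) → (∃ c : ℝ, 0 < c ∧ ∀ n : ℕ, 1 ≤ n → Literature.Probability.LatticeModels.isingTwoPoint (Literature.Probability.LatticeModels.zdGraph 3) (Fintype.piFinset fun i : Fin 3 => Finset.Icc ((fun _ : Fin 3 => 1 - (((n + 1) / 2 : ℕ) : ℤ)) i) ((fun i : Fin 3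 => if i = 0 then (n : ℤ) + (((n + 1) / 2 : ℕ) : ℤ) - 1 else (((n + 1) / 2 : ℕ) : ℤ) - 1) i)) (Literature.Probability.LatticeModels.criticalBeta 3) 0 .free 0 (Pi.single 0 (n : ℤ)) ≤ (1 - c) * Literature.Probability.LatticeModels.criticalTwoPoint 3 (Pi.single 0 (n : ℤ))) := by
  rintro ⟨c, hc, h⟩
  exact ⟨c, hc, fun n hn => (freeA_le_freeC n hn).trans (h n hn)⟩

end Summit.CriticalPhenomena.Ising3DConformalLimit.ReflectionTwinExistsContinuousLimit.FreeBox

end
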